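import Mathlib
import Summits.MatrixMultiplication.MatrixMultiplication.Theorems.LieRankDesigns.Negative.Basics

/-!
# Negative lemmas for the crux `LieRankDesigns` (stmt-MatrixMultiplication-7614), part G: token counts for private-token designs

Lead-side (line `Sketch`, seat prover-line-stmt-MatrixMultiplication-7614-c3) support for the open design stub G''
`stub_nearWallDesigns` at its level-one cells `(m, 1)`; no theorem here asserts a Theses statement positively.

A triple `X, Y, Z ⊆ GL_m(𝔽_p)` with a PRIVATE-TOKEN witness `v : X × Z → 𝔽_p^m` —
`x⁻¹ y y'⁻¹ z · v(x₀,z₀) = x₀⁻¹ z₀ · v(x₀,z₀) ⟹ (x, y, y', z)` trivial — is rank-one separated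
(`Theorems.LieRankDesigns.stub_rankSepOfPrivateTokens`, the constructive mechanism of the `(m,1)` cells).  Two counts
every such witness obeys, for every vector `w` (the first two steps of the "token cascade", `G2-status-c3.md`):

* `card_targets_token_le` (TOKEN INJECTIVITY): the targets using the token vector `w` are mapped injectively into
  `𝔽_p^m` by `(x₀, z₀) ↦ x₀⁻¹ z₀ w` (two of them would violate each other through a pair product `x₁⁻¹ y y⁻¹ z₁`), so
  `#{(x₀,z₀) ∈ X × Z : v(x₀,z₀) = w} ≤ p^m` (`Y ≠ ∅`);
* `card_mul_card_fibre_le` (Z-SINGLETONS): with `Z_w = {z₀ ∈ Z : ∃ x₀ ∈ X, v(x₀,z₀) = w}`, the map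
  `(y, z₀) ↦ y⁻¹ z₀ w` is injective on `Y × Z_w` (a coincidence `y⁻¹z₀w = y₁⁻¹z₁w` is the violating quadruple
  `(x₀, y, y₁, z₁)` of the target `(x₀, z₀)`), so `|Y| · |Z_w| ≤ p^m`: a token vector serves at most `p^m/|Y|` third
  elements — `≈ √p` at the wall `|Y| ≈ p^{m−1/2}` — so the witness direction is essentially a function of `z₀`, spread
  over `≳ p^{m−1}` lines.
-/

set_option linter.dupNamespace false

noncomputable section

open scoped BigOperators

namespace Summit.MatrixMultiplication.MatrixMultiplication.Theorems.LieRankDesigns.Negative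

variable {p m : ℕ} [Fact p.Prime]

omit [Fact p.Prime] in
/-- `(g h) · w = g · (h · w)` for `g, h ∈ GL_m(𝔽_p)` acting on column vectors. -/
theorem coe_mul_mulVec (g h : GLm p m) (w : Fin m → ZMod p) :
    ((g * h : GLm p m) : Mat p m).mulVec w = (g : Mat p m).mulVec ((h : Mat p m).mulVec w) := by
  rw [Units.val_mul, Matrix.mulVec_mulVec]

/-- **Token injectivity.**  For a private-token witness `v` and any vector `w`, the targets `(x₀, z₀)` with
`v x₀ z₀ = w` number at most `p^m` (they are mapped injectively to `x₀⁻¹ z₀ w ∈ 𝔽_p^m`; needs `Y ≠ ∅`). -/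
theorem card_targets_token_le (X Y Z : Finset (GLm p m)) (v : GLm p m → GLm p m → (Fin m → ZMod p))
    (hPT : ∀ x₀ ∈ X, ∀ z₀ ∈ Z, ∀ x ∈ X, ∀ y ∈ Y, ∀ y' ∈ Y, ∀ z ∈ Z,
      ((x⁻¹ * y * y'⁻¹ * z : GLm p m) : Mat p m).mulVec (v x₀ z₀) =
        ((x₀⁻¹ * z₀ : GLm p m) : Mat p m).mulVec (v x₀ z₀) → x = x₀ ∧ y = y' ∧ z = z₀)
    (hY : Y.Nonempty) (w : Fin m → ZMod p) :
    ((X ×ˢ Z).filter fun t => v t.1 t.2 = w).card ≤ p ^ m := by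
  classical
  obtain ⟨y, hy⟩ := hY
  have hcard : (Finset.univ : Finset (Fin m → ZMod p)).card = p ^ m := by
    rw [Finset.card_univ, Fintype.card_pi, Finset.prod_const, ZMod.card, Finset.card_univ, Fintype.card_fin]
  rw [← hcard]
  refine Finset.card_le_card_of_injOn (fun t => ((t.1⁻¹ * t.2 : GLm p m) : Mat p m).mulVec w)
    (fun t _ => Finset.mem_univ _) ?_
  rintro ⟨x₀, z₀⟩ h₀ ⟨x₁, z₁⟩ h₁ heq
  simp only [Finset.coe_filter, Finset.mem_product, Set.mem_setOf_eq] at h₀ h₁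
  obtain ⟨⟨hx₀, hz₀⟩, hv₀⟩ := h₀
  obtain ⟨⟨hx₁, hz₁⟩, -⟩ := h₁
  -- the quadruple (x₁, y, y, z₁) of the target (x₀, z₀)
  have key : ((x₁⁻¹ * y * y⁻¹ * z₁ : GLm p m) : Mat p m).mulVec (v x₀ z₀) =
      ((x₀⁻¹ * z₀ : GLm p m) : Mat p m).mulVec (v x₀ z₀) := by
    rw [mul_inv_cancel_right, hv₀]
    exact heq.symm
  obtain ⟨hxx, -, hzz⟩ := hPT x₀ hx₀ z₀ hz₀ x₁ hx₁ y hy y hy z₁ hz₁ key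
  rw [hxx, hzz]

/-- **Z-singletons.**  For a private-token witness `v` and any vector `w`, with
`Z_w = {z₀ ∈ Z : ∃ x₀ ∈ X, v x₀ z₀ = w}`: `|Y| · |Z_w| ≤ p^m` (the map `(y, z₀) ↦ y⁻¹ z₀ w` is injective on `Y × Z_w`). -/
theorem card_mul_card_fibre_le (X Y Z : Finset (GLm p m)) (v : GLm p m → GLm p m → (Fin m → ZMod p))
    (hPT : ∀ x₀ ∈ X, ∀ z₀ ∈ Z, ∀ x ∈ X, ∀ y ∈ Y, ∀ y' ∈ Y, ∀ z ∈ Z,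
      ((x⁻¹ * y * y'⁻¹ * z : GLm p m) : Mat p m).mulVec (v x₀ z₀) =
        ((x₀⁻¹ * z₀ : GLm p m) : Mat p m).mulVec (v x₀ z₀) → x = x₀ ∧ y = y' ∧ z = z₀)
    (w : Fin m → ZMod p) :
    Y.card * (Z.filter fun z₀ => ∃ x₀ ∈ X, v x₀ z₀ = w).card ≤ p ^ m := by
  classical
  have hcard : (Finset.univ : Finset (Fin m → ZMod p)).card = p ^ m := by
    rw [Finset.card_univ, Fintype.card_pi, Finset.prod_const, ZMod.card, Finset.card_univ, Fintype.card_fin]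
  rw [← hcard, ← Finset.card_product]
  refine Finset.card_le_card_of_injOn (fun q => ((q.1⁻¹ * q.2 : GLm p m) : Mat p m).mulVec w)
    (fun q _ => Finset.mem_univ _) ?_
  rintro ⟨y, z₀⟩ h₀ ⟨y₁, z₁⟩ h₁ heq
  simp only [Finset.coe_product, Finset.coe_filter, Set.mem_prod, Finset.mem_coe, Set.mem_setOf_eq] at h₀ h₁
  obtain ⟨hy, hz₀, x₀, hx₀, hv₀⟩ := h₀
  obtain ⟨hy₁, hz₁, -⟩ := h₁
  -- the quadruple (x₀, y, y₁, z₁) of the target (x₀, z₀)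
  have heq' : ((y₁⁻¹ * z₁ : GLm p m) : Mat p m).mulVec w = ((y⁻¹ * z₀ : GLm p m) : Mat p m).mulVec w := heq.symm
  have key : ((x₀⁻¹ * y * y₁⁻¹ * z₁ : GLm p m) : Mat p m).mulVec (v x₀ z₀) =
      ((x₀⁻¹ * z₀ : GLm p m) : Mat p m).mulVec (v x₀ z₀) := by
    rw [hv₀]
    have e1 : (x₀⁻¹ * y * y₁⁻¹ * z₁ : GLm p m) = x₀⁻¹ * y * (y₁⁻¹ * z₁) := by group
    have e2 : (x₀⁻¹ * z₀ : GLm p m) = x₀⁻¹ * y * (y⁻¹ * z₀) := by group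
    rw [e1, e2, coe_mul_mulVec (x₀⁻¹ * y), coe_mul_mulVec (x₀⁻¹ * y), heq']
  obtain ⟨-, hyy, hzz⟩ := hPT x₀ hx₀ z₀ hz₀ x₀ hx₀ y hy y₁ hy₁ z₁ hz₁ key
  rw [hyy, hzz]

end Summit.MatrixMultiplication.MatrixMultiplication.Theorems.LieRankDesigns.Negative

end
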